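import Literature.Analysis.Distribution.DivFormRegularity
import Literature.Analysis.Distribution.SumOfSquaresDecomposition
import Literature.Analysis.Hypoelliptic.HormanderProof
import HarnessLib

/-!
# Interior regularity of very weak solutions of second-order parabolic equations with smooth
# coefficients: the heat operator is a Hörmander sum of squares

Analysis/Distribution support file for the discharge of the named fact
`Literature.Geometry.Riemannian.perelman_noLocalCollapsing` (Perelman 2002, Thm. 4.1), whose
only missing input is the solvability of the linear heat-type Cauchy problem
`∂ₛw = Δ_{h(s)}w − Qw` on a closed manifold (`perelman_noLocalCollapsing_of_linearHeat`,
`PerelmanNoncollapsingLinearHeat.lean`). The REGULARITY half of that existence theorem is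
supplied here, in coordinates: a very weak (`L¹_loc`) solution of a second-order parabolic
equation with smooth coefficients is smooth. This is the textbook application of

  L. Hörmander, *Hypoelliptic second order differential equations*, Acta Math. 119 (1967),
  Thm 1.1 — PROVED in this tree (`Literature.Analysis.Hypoelliptic.hormander1967_thm11_proof`,
  the named fact `Hormander1967_thm11` of `Hypoelliptic.lean`),

to the operator `P = ∑ⱼ Yⱼ² + Y₀ + c` obtained from the heat operator: Hörmander's
introduction (p. 147) singles out exactly this example ("the equation … of Kolmogorov … and of
course the heat equation" are hypoelliptic although not elliptic).

* `heatTranspose A J q ψ = −∂ₛ(Jψ) − ∑ₖ ∂ₖ(∑ₗ Aₖₗ ∂ₗψ) + qψ` on `ℝᵐ × ℝ` — the formal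
  transpose (Lebesgue measure) of `u ↦ J∂ₛu − ∑ₗ∂ₗ(Aₖₗ∂ₖu) + qu`; for the chart data
  `A = √(det h) h⁻¹`, `J = √(det h)`, `q = √(det h) Q` of a smooth family of Riemannian metrics this
  is `√(det h) (∂ₛ − Δ_{h(s)} + Q)` (divergence form of the Laplace–Beltrami operator,
  Chavel 2006, §III.7).
* `heatDriftField`, `heatSquareField` and **`hormanderTranspose_eq_neg_heatTranspose`** — with
  `A = ∑ⱼ gⱼ² wⱼwⱼᵀ` (constant `wⱼ`, smooth `gⱼ`: `exists_smooth_sumOfSquares`,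
  `SumOfSquaresDecomposition.lean`), `Yⱼ = gⱼ(wⱼ, 0)`, `Y₀ = ∑ₖ ½(∑ₗ∂ₗAₖₗ)(eₖ, 0) − J(0, 1)`,
  `c = −q`: `ᵗP = −heatTranspose A J q` (`ᵗYⱼᵗYⱼψ = ∂_W(gⱼ∂_W(gⱼψ))`, the first-order parts
  cancelling against `ᵗY₀`); the field calculus `fieldTranspose_smul_const`
  (`ᵗ(f∂ᵥ)ψ = −∂ᵥ(fψ)`), `fieldTranspose_sum_smul_const`,
  `fieldTranspose_fieldTranspose_smul_const`.
* `isBracketGenerating_heat` — `Y₁,…,Y_r, Y₀` span `ℝᵐ × ℝ` at every point (the bracket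
  condition of Thm 1.1 at step zero).
* **`exists_contDiffOn_ae_eq_of_heat_veryWeak`** — if `u ∈ L¹_loc(Ω)`, `Ω ⊆ ℝᵐ × ℝ` open,
  satisfies `∫ u · heatTranspose A J q ψ = ∫ F ψ` for all `ψ ∈ C_c^∞(Ω)`, with `A` smooth
  symmetric positive definite, `J > 0`, `q, F` smooth on `Ω`, then near every point of `Ω` it
  agrees a.e. with a `C^∞` function (cut-off, sum of squares, Thm 1.1, fundamental lemma of the
  calculus of variations — the pattern of `DivFormRegularity.lean` for the elliptic case).

Everything is proved; three definitions (`heatTranspose`, `heatDriftField`,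
`heatSquareField`, with unfolding lemmas), no named facts.

## References

* L. Hörmander, *Hypoelliptic second order differential equations*, Acta Math. 119 (1967)
  147–171, p. 147, (1.6), Thm 1.1. [Hormander1967]
* I. Chavel, *Riemannian Geometry: A Modern Introduction*, 2nd ed., CUP 2006, §III.7 (the
  Laplacian in local coordinates). [Chavel2006]
-/

noncomputable section

open MeasureTheory TopologicalSpace Set Function Filter Distributions Metric Module
open scoped ContDiff Topology

namespace Literature.Analysis.Distribution

/-! ### Formal transposes of vector fields of the form `∑ᵣ fᵣ(p) vᵣ` -/

section FieldCalculus

variable {V : Type*} [NormedAddCommGroup V] [NormedSpace ℝ V] [FiniteDimensional ℝ V]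

/-- The divergence of `p ↦ f(p) v` (`v` constant) is `∂_v f`. [folklore] -/
theorem fieldDiv_smul_const {f : V → ℝ} {p : V} (hf : DifferentiableAt ℝ f p) (v : V) :
    fieldDiv (fun z ↦ f z • v) p = fderiv ℝ f p v := by
  unfold fieldDiv
  rw [fderiv_smul_const hf v]
  exact LinearMap.trace_smulRight _ _

/-- **`ᵗ(f ∂_v) ψ = −∂_v(f ψ)`**: the formal transpose of the field `p ↦ f(p) v`. [folklore] -/
theorem fieldTranspose_smul_const {f ψ : V → ℝ} {p : V} (hf : DifferentiableAt ℝ f p)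
    (hψ : DifferentiableAt ℝ ψ p) (v : V) :
    fieldTranspose (fun z ↦ f z • v) ψ p = -fderiv ℝ (fun z ↦ f z * ψ z) p v := by
  unfold fieldTranspose
  rw [fieldDiv_smul_const hf v, fieldDeriv_apply, fderiv_fun_mul hf hψ]
  simp [smul_eq_mul]
  ring

/-- The divergence of a finite sum `∑ᵣ fᵣ(p) vᵣ` of such fields is `∑ᵣ ∂_{vᵣ} fᵣ`. [folklore] -/
theorem fieldDiv_sum_smul_const {ι' : Type*} (s : Finset ι') {f : ι' → V → ℝ} {p : V}
    (hf : ∀ r ∈ s, DifferentiableAt ℝ (f r) p) (v : ι' → V) :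
    fieldDiv (fun z ↦ ∑ r ∈ s, f r z • v r) p = ∑ r ∈ s, fderiv ℝ (f r) p (v r) := by
  simp only [fieldDiv_eq_traceCLM_comp, Function.comp_apply]
  rw [fderiv_fun_sum fun r hr ↦ (hf r hr).smul_const (v r), map_sum]
  refine Finset.sum_congr rfl fun r hr ↦ ?_
  rw [fderiv_smul_const (hf r hr), traceCLM_apply]
  exact LinearMap.trace_smulRight _ _

/-- The formal transpose of a finite sum `∑ᵣ fᵣ(p) vᵣ` of such fields:
`ᵗX ψ = −∑ᵣ ∂_{vᵣ}(fᵣ ψ)`. [folklore] -/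
theorem fieldTranspose_sum_smul_const {ι' : Type*} (s : Finset ι') {f : ι' → V → ℝ}
    {ψ : V → ℝ} {p : V} (hf : ∀ r ∈ s, DifferentiableAt ℝ (f r) p)
    (hψ : DifferentiableAt ℝ ψ p) (v : ι' → V) :
    fieldTranspose (fun z ↦ ∑ r ∈ s, f r z • v r) ψ p =
      -∑ r ∈ s, fderiv ℝ (fun z ↦ f r z * ψ z) p (v r) := by
  unfold fieldTranspose
  rw [fieldDiv_sum_smul_const s hf v, fieldDeriv_apply, map_sum]
  have hterm : ∀ r ∈ s, fderiv ℝ (fun z ↦ f r z * ψ z) p (v r) =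
      f r p * fderiv ℝ ψ p (v r) + fderiv ℝ (f r) p (v r) * ψ p := by
    intro r hr
    rw [fderiv_fun_mul (hf r hr) hψ]
    simp [smul_eq_mul]
    ring
  rw [Finset.sum_congr rfl hterm, Finset.sum_add_distrib, Finset.sum_mul]
  simp only [map_smul, smul_eq_mul]
  ring

/-- **The square of a field `Y = g(p) W`**: `ᵗY(ᵗY ψ)(p) = ∂_W (g ∂_W(g ψ))(p)`. [folklore] -/
theorem fieldTranspose_fieldTranspose_smul_const {g ψ : V → ℝ} (hg : ContDiff ℝ ∞ g)
    (hψ : ContDiff ℝ ∞ ψ) (W : V) (p : V) :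
    fieldTranspose (fun z ↦ g z • W) (fieldTranspose (fun z ↦ g z • W) ψ) p =
      fderiv ℝ (fun z ↦ g z * fderiv ℝ (fun z' ↦ g z' * ψ z') z W) p W := by
  have hgd : Differentiable ℝ g := hg.differentiable (by simp)
  have hψd : Differentiable ℝ ψ := hψ.differentiable (by simp)
  have hgψ : ContDiff ℝ ∞ fun z ↦ g z * ψ z := hg.mul hψ
  have hD : ContDiff ℝ ∞ fun z ↦ fderiv ℝ (fun z' ↦ g z' * ψ z') z W :=
    (hgψ.fderiv_right (m := ∞) (by exact_mod_cast le_top)).clm_apply contDiff_const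
  have hinner : fieldTranspose (fun z ↦ g z • W) ψ = fun z ↦ -fderiv ℝ (fun z' ↦ g z' * ψ z') z W :=
    funext fun z ↦ fieldTranspose_smul_const (hgd z) (hψd z) W
  rw [hinner, fieldTranspose_smul_const (hgd p) (hD.neg.differentiable (by simp) p) W]
  have : (fun z ↦ g z * -fderiv ℝ (fun z' ↦ g z' * ψ z') z W) =
      fun z ↦ -(g z * fderiv ℝ (fun z' ↦ g z' * ψ z') z W) := funext fun z ↦ by ring
  rw [this, fderiv_fun_neg]
  simp

omit [FiniteDimensional ℝ V] in
/-- The inner function of the square: `g ∂_W(g ψ) = g² ∂_W ψ + ½ ∂_W(g²) ψ`. [folklore] -/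
theorem mul_fderiv_mul_apply {g ψ : V → ℝ} {z : V} (hg : DifferentiableAt ℝ g z)
    (hψ : DifferentiableAt ℝ ψ z) (W : V) :
    g z * fderiv ℝ (fun z' ↦ g z' * ψ z') z W =
      g z ^ 2 * fderiv ℝ ψ z W + (1 / 2) * fderiv ℝ (fun z' ↦ g z' ^ 2) z W * ψ z := by
  rw [fderiv_fun_mul hg hψ, show (fun z' ↦ g z' ^ 2) = fun z' ↦ g z' * g z' from
    funext fun z' ↦ sq (g z'), fderiv_fun_mul hg hg]
  simp [smul_eq_mul]
  ring

end FieldCalculus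

/-! ### The weighted heat operator on `ℝᵐ × ℝ` and its Hörmander presentation -/

section Heat

variable {m : ℕ}

/-- The space-time model `ℝᵐ × ℝ`, points `p = (y, s)`. -/
local notation "𝔼" => EuclideanSpace ℝ (Fin m) × ℝ
/-- The standard basis of `ℝᵐ`. -/
local notation "𝐛" => OrthonormalBasis.toBasis (EuclideanSpace.basisFun (Fin m) ℝ)

/-- **The formal transpose of the weighted heat operator in coordinates.** For a matrix field
`A = (Aₖₗ)`, a weight `J` and a potential `q` on `ℝᵐ × ℝ`,
`heatTranspose A J q ψ = −∂ₛ(J ψ) − ∑ₖ ∂ₖ(∑ₗ Aₖₗ ∂ₗψ) + q ψ`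
(`∂ₖ` along `(eₖ, 0)`, `∂ₛ` along `(0, 1)`): the transpose, with respect to Lebesgue measure
`dy ds`, of `u ↦ J ∂ₛu − ∑ₗ ∂ₗ(Aₖₗ ∂ₖu)ᵀ… = J (∂ₛ − Δ_h + Q) u` when `Aₖₗ = √(det h) hᵏˡ`,
`J = √(det h)`, `q = √(det h) Q` are the chart data of a family of Riemannian metrics `h(s)`
(Chavel 2006, §III.7: `√g Δ_h = ∑ ∂ₖ(√g gᵏˡ ∂ₗ)`). [cite: Hormander1967, eq. (1.6)] -/
def heatTranspose (A : Fin m → Fin m → 𝔼 → ℝ) (J q ψ : 𝔼 → ℝ) (p : 𝔼) : ℝ :=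
  -(fderiv ℝ (fun z ↦ J z * ψ z) p ((0 : EuclideanSpace ℝ (Fin m)), (1 : ℝ))) -
    (∑ k, fderiv ℝ (fun z ↦ ∑ l, A k l z * fderiv ℝ ψ z (𝐛 l, 0)) p (𝐛 k, 0)) +
    q p * ψ p

/-- Unfolding `heatTranspose`. [folklore] -/
theorem heatTranspose_apply (A : Fin m → Fin m → 𝔼 → ℝ) (J q ψ : 𝔼 → ℝ) (p : 𝔼) :
    heatTranspose A J q ψ p =
      -(fderiv ℝ (fun z ↦ J z * ψ z) p ((0 : EuclideanSpace ℝ (Fin m)), (1 : ℝ))) -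
        (∑ k, fderiv ℝ (fun z ↦ ∑ l, A k l z * fderiv ℝ ψ z (𝐛 l, 0)) p (𝐛 k, 0)) +
        q p * ψ p := rfl

variable {ι : Type*} [Fintype ι]

/-- The drift field of the Hörmander presentation of the weighted heat operator:
`Y₀ = ∑ₖ ½(∑ₗ ∂ₗAₖₗ) (eₖ, 0) − J (0, 1)`, written as a sum over `Option (Fin m)`
(`none ↦` the time direction). [cite: Hormander1967, eq. (1.6)] -/
def heatDriftField (A : Fin m → Fin m → 𝔼 → ℝ) (J : 𝔼 → ℝ) (z : 𝔼) : 𝔼 :=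
  ∑ o : Option (Fin m), (o.elim (-J z) fun k ↦ (1 / 2) * ∑ l, fderiv ℝ (A k l) z (𝐛 l, 0)) •
    (o.elim ((0 : EuclideanSpace ℝ (Fin m)), (1 : ℝ)) fun k ↦ ((𝐛 k : EuclideanSpace ℝ (Fin m)), (0 : ℝ)))

/-- The square fields of the Hörmander presentation: `Yⱼ = gⱼ · (wⱼ, 0)`,
`(wⱼ, 0) = ∑ₖ wⱼ(k) (eₖ, 0)`. [cite: Hormander1967, eq. (1.6)] -/
def heatSquareField (w : ι → Fin m → ℝ) (g : ι → 𝔼 → ℝ) (j : ι) (z : 𝔼) : 𝔼 :=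
  g j z • ∑ k, w j k • ((𝐛 k : EuclideanSpace ℝ (Fin m)), (0 : ℝ))

/-- Unfolding `heatDriftField`. [folklore] -/
theorem heatDriftField_def (A : Fin m → Fin m → 𝔼 → ℝ) (J : 𝔼 → ℝ) :
    heatDriftField A J = fun z ↦ ∑ o : Option (Fin m),
      (o.elim (-J z) fun k ↦ (1 / 2) * ∑ l, fderiv ℝ (A k l) z (𝐛 l, 0)) •
        (o.elim ((0 : EuclideanSpace ℝ (Fin m)), (1 : ℝ))
          fun k ↦ ((𝐛 k : EuclideanSpace ℝ (Fin m)), (0 : ℝ))) := rfl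

omit [Fintype ι] in
/-- Unfolding `heatSquareField`. [folklore] -/
theorem heatSquareField_def (w : ι → Fin m → ℝ) (g : ι → 𝔼 → ℝ) :
    heatSquareField w g = fun j z ↦ g j z • ∑ k, w j k • ((𝐛 k : EuclideanSpace ℝ (Fin m)), (0 : ℝ)) :=
  rfl

/-- The time component of the drift field is `−J`. [folklore] -/
theorem snd_heatDriftField (A : Fin m → Fin m → 𝔼 → ℝ) (J : 𝔼 → ℝ) (z : 𝔼) :
    (heatDriftField A J z).2 = -J z := by
  simp [heatDriftField, Prod.snd_sum, Fintype.sum_option]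

/-- The spatial component of the drift field. [folklore] -/
theorem fst_heatDriftField (A : Fin m → Fin m → 𝔼 → ℝ) (J : 𝔼 → ℝ) (z : 𝔼) :
    (heatDriftField A J z).1 =
      ∑ k, ((1 / 2) * ∑ l, fderiv ℝ (A k l) z (𝐛 l, 0)) • (𝐛 k : EuclideanSpace ℝ (Fin m)) := by
  simp [heatDriftField, Prod.fst_sum, Fintype.sum_option]

/-- The drift field is smooth for smooth data. [folklore] -/
theorem contDiff_heatDriftField {A : Fin m → Fin m → 𝔼 → ℝ} {J : 𝔼 → ℝ}
    (hA : ∀ k l, ContDiff ℝ ∞ (A k l)) (hJ : ContDiff ℝ ∞ J) :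
    ContDiff ℝ ∞ (heatDriftField A J) := by
  rw [heatDriftField_def]
  refine ContDiff.sum fun o _ ↦ ?_
  cases o with
  | none => exact hJ.neg.smul contDiff_const
  | some k => exact (contDiff_const.mul (ContDiff.sum fun l _ ↦
      ((hA k l).fderiv_right (m := ∞) (by exact_mod_cast le_top)).clm_apply
        contDiff_const)).smul contDiff_const

omit [Fintype ι] in
/-- The square fields are smooth for smooth `g`. [folklore] -/
theorem contDiff_heatSquareField {w : ι → Fin m → ℝ} {g : ι → 𝔼 → ℝ}
    (hg : ∀ j, ContDiff ℝ ∞ (g j)) (j : ι) : ContDiff ℝ ∞ (heatSquareField w g j) :=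
  (hg j).smul contDiff_const

/-- **The heat operator is of Hörmander's form.** Let `Aₖₗ(p) = ∑ⱼ gⱼ(p)² wⱼ(k) wⱼ(l)` with
smooth `gⱼ` and constant vectors `wⱼ` (as produced by `exists_smooth_sumOfSquares`), `J, q`
smooth. With the vector fields `Yⱼ = gⱼ · (wⱼ, 0)` (`heatSquareField`),
`Y₀ = ∑ₖ ½(∑ₗ ∂ₗAₖₗ) (eₖ, 0) − J (0, 1)` (`heatDriftField`) and `c = −q`, the formal
transpose of Hörmander's operator `∑ⱼ Yⱼ² + Y₀ + c` is `−heatTranspose A J q`: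
`∑ⱼ ᵗYⱼ(ᵗYⱼψ) + ᵗY₀ψ + cψ = ∂ₛ(Jψ) + ∑ₖ ∂ₖ(∑ₗ Aₖₗ ∂ₗψ) − qψ`
(`ᵗYⱼ(ᵗYⱼψ) = ∂_W(gⱼ ∂_W(gⱼψ)) = ∂_W(gⱼ² ∂_Wψ + ½∂_W(gⱼ²)ψ)`, `W = (wⱼ, 0)`, summed with
`∑ⱼ gⱼ² wⱼwⱼᵀ = A`; the first-order parts `½ ∑ₖ ∂ₖ((∑ₗ∂ₗAₖₗ)ψ)` cancel against `ᵗY₀`).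
[cite: Hormander1967, eq. (1.6)] -/
theorem hormanderTranspose_eq_neg_heatTranspose {A : Fin m → Fin m → 𝔼 → ℝ}
    {w : ι → Fin m → ℝ} {g : ι → 𝔼 → ℝ} (hg : ∀ j, ContDiff ℝ ∞ (g j))
    (hA : ∀ p k l, A k l p = ∑ j, g j p ^ 2 * (w j k * w j l)) {J q : 𝔼 → ℝ}
    (hJ : ContDiff ℝ ∞ J) {ψ : 𝔼 → ℝ} (hψ : ContDiff ℝ ∞ ψ) (p : 𝔼) :
    hormanderTranspose (heatDriftField A J) (heatSquareField w g) (fun z ↦ -q z) ψ p =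
      -heatTranspose A J q ψ p := by
  rw [heatDriftField_def, heatSquareField_def]
  -- notation and smoothness
  set e : Fin m → 𝔼 := fun k ↦ ((𝐛 k : EuclideanSpace ℝ (Fin m)), (0 : ℝ)) with he
  set et : 𝔼 := ((0 : EuclideanSpace ℝ (Fin m)), (1 : ℝ)) with het
  set Wv : ι → 𝔼 := fun j ↦ ∑ k, w j k • e k with hWv
  have hAfun : ∀ k l, A k l = fun z ↦ ∑ j, g j z ^ 2 * (w j k * w j l) :=
    fun k l ↦ funext fun z ↦ hA z k l
  have hg2 : ∀ j, ContDiff ℝ ∞ fun z ↦ g j z ^ 2 := fun j ↦ (hg j).pow 2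
  have hAs : ∀ k l, ContDiff ℝ ∞ (A k l) := by
    intro k l; rw [hAfun k l]; exact ContDiff.sum fun j _ ↦ (hg2 j).mul contDiff_const
  have hdψ : ∀ v : 𝔼, ContDiff ℝ ∞ fun z ↦ fderiv ℝ ψ z v := fun v ↦
    (hψ.fderiv_right (m := ∞) (by exact_mod_cast le_top)).clm_apply contDiff_const
  have hdA : ∀ k l (v : 𝔼), ContDiff ℝ ∞ fun z ↦ fderiv ℝ (A k l) z v := fun k l v ↦
    ((hAs k l).fderiv_right (m := ∞) (by exact_mod_cast le_top)).clm_apply contDiff_const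
  have hdg2 : ∀ j (v : 𝔼), ContDiff ℝ ∞ fun z ↦ fderiv ℝ (fun z' ↦ g j z' ^ 2) z v := fun j v ↦
    ((hg2 j).fderiv_right (m := ∞) (by exact_mod_cast le_top)).clm_apply contDiff_const
  have hD : ∀ {F : 𝔼 → ℝ}, ContDiff ℝ ∞ F → ∀ z, DifferentiableAt ℝ F z := fun hF z ↦
    hF.differentiable (by simp) z
  set β : Fin m → 𝔼 → ℝ := fun k z ↦ (1 / 2) * ∑ l, fderiv ℝ (A k l) z (e l) with hβ
  have hβs : ∀ k, ContDiff ℝ ∞ (β k) := fun k ↦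
    contDiff_const.mul (ContDiff.sum fun l _ ↦ hdA k l (e l))
  -- derivative of the sum-of-squares identity: `∂_v Aₖₗ = ∑ⱼ wⱼ(k)wⱼ(l) ∂_v(gⱼ²)`
  have hdA_eq : ∀ k l z (v : 𝔼), fderiv ℝ (A k l) z v =
      ∑ j, (w j k * w j l) * fderiv ℝ (fun z' ↦ g j z' ^ 2) z v := by
    intro k l z v
    rw [hAfun k l, fderiv_fun_sum fun j _ ↦ (hD (hg2 j) z).mul_const _,
      _root_.sum_apply]
    refine Finset.sum_congr rfl fun j _ ↦ ?_
    rw [fderiv_mul_const (hD (hg2 j) z)]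
    simp [smul_eq_mul]
  -- (1) the squares: `ᵗYⱼ(ᵗYⱼψ)(p) = ∑ₖ wⱼ(k) ∂ₖ Tⱼ (p)`, `Tⱼ = ∑ₗ wⱼ(l) (gⱼ² ∂ₗψ + ½ ∂ₗ(gⱼ²) ψ)`
  set T : ι → 𝔼 → ℝ := fun j z ↦ ∑ l, w j l * (g j z ^ 2 * fderiv ℝ ψ z (e l) +
    (1 / 2) * fderiv ℝ (fun z' ↦ g j z' ^ 2) z (e l) * ψ z) with hT
  have hTs : ∀ j, ContDiff ℝ ∞ (T j) := fun j ↦ ContDiff.sum fun l _ ↦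
    contDiff_const.mul (((hg2 j).mul (hdψ (e l))).add
      ((contDiff_const.mul (hdg2 j (e l))).mul hψ))
  have hlin : ∀ {F : 𝔼 → ℝ} (z : 𝔼) (j : ι), fderiv ℝ F z (Wv j) = ∑ k, w j k * fderiv ℝ F z (e k) := by
    intro F z j
    simp only [hWv, map_sum, map_smul, smul_eq_mul]
  have hinner : ∀ j, (fun z ↦ g j z * fderiv ℝ (fun z' ↦ g j z' * ψ z') z (Wv j)) = T j := by
    intro j; funext z
    rw [mul_fderiv_mul_apply (hD (hg j) z) (hD hψ z) (Wv j), hlin, hlin, hT]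
    simp only [Finset.mul_sum]
    rw [Finset.sum_mul, ← Finset.sum_add_distrib]
    refine Finset.sum_congr rfl fun l _ ↦ by ring
  have hsq : ∀ j, fieldTranspose (fun z ↦ g j z • Wv j) (fieldTranspose (fun z ↦ g j z • Wv j) ψ) p =
      ∑ k, w j k * fderiv ℝ (T j) p (e k) := by
    intro j
    rw [fieldTranspose_fieldTranspose_smul_const (hg j) hψ (Wv j) p, hinner j, hlin]
  -- (2) summing the squares: `∑ⱼ ∑ₖ wⱼ(k) ∂ₖTⱼ = ∑ₖ ∂ₖ(∑ₗ Aₖₗ∂ₗψ) + ∑ₖ ∂ₖ(βₖ ψ)`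
  have hsumT : ∀ k z, ∑ j, w j k * T j z =
      (∑ l, A k l z * fderiv ℝ ψ z (e l)) + β k z * ψ z := by
    intro k z
    simp only [hT, hβ, Finset.mul_sum, Finset.sum_mul]
    rw [← Finset.sum_add_distrib]
    have : ∀ l, ∑ j, w j k * (w j l * (g j z ^ 2 * fderiv ℝ ψ z (e l) +
        1 / 2 * fderiv ℝ (fun z' ↦ g j z' ^ 2) z (e l) * ψ z)) =
        A k l z * fderiv ℝ ψ z (e l) + 1 / 2 * fderiv ℝ (A k l) z (e l) * ψ z := by
      intro l
      rw [hA z k l, hdA_eq k l z (e l), Finset.sum_mul, Finset.mul_sum, Finset.sum_mul,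
        ← Finset.sum_add_distrib]
      refine Finset.sum_congr rfl fun j _ ↦ by ring
    rw [Finset.sum_comm]
    exact Finset.sum_congr rfl fun l _ ↦ this l
  have hsquares : ∑ j, fieldTranspose (fun z ↦ g j z • Wv j)
      (fieldTranspose (fun z ↦ g j z • Wv j) ψ) p =
      (∑ k, fderiv ℝ (fun z ↦ ∑ l, A k l z * fderiv ℝ ψ z (e l)) p (e k)) +
        ∑ k, fderiv ℝ (fun z ↦ β k z * ψ z) p (e k) := by
    simp_rw [hsq]
    rw [Finset.sum_comm, ← Finset.sum_add_distrib]
    refine Finset.sum_congr rfl fun k _ ↦ ?_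
    -- `∑ⱼ wⱼ(k) ∂ₖ Tⱼ (p) = ∂ₖ (∑ⱼ wⱼ(k) Tⱼ)(p)`
    have h1 : ∑ j, w j k * fderiv ℝ (T j) p (e k) =
        fderiv ℝ (fun z ↦ ∑ j, w j k * T j z) p (e k) := by
      rw [fderiv_fun_sum fun j _ ↦ (hD (hTs j) p).const_mul _, _root_.sum_apply]
      refine Finset.sum_congr rfl fun j _ ↦ ?_
      rw [fderiv_const_mul (hD (hTs j) p)]
      simp [smul_eq_mul]
    rw [h1, show (fun z ↦ ∑ j, w j k * T j z) =
      (fun z ↦ ∑ l, A k l z * fderiv ℝ ψ z (e l)) + fun z ↦ β k z * ψ z from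
        funext fun z ↦ by rw [hsumT k z]; rfl]
    rw [fderiv_add (hD (ContDiff.sum fun l _ ↦ (hAs k l).mul (hdψ (e l))) p)
      (hD ((hβs k).mul hψ) p)]
    rfl
  -- (3) the field `Y₀`
  have hY0 : fieldTranspose (fun z ↦ ∑ o : Option (Fin m),
      (o.elim (-J z) fun k ↦ (1 / 2) * ∑ l, fderiv ℝ (A k l) z (e l)) • (o.elim et fun k ↦ e k)) ψ p =
      fderiv ℝ (fun z ↦ J z * ψ z) p et - ∑ k, fderiv ℝ (fun z ↦ β k z * ψ z) p (e k) := by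
    rw [fieldTranspose_sum_smul_const (Finset.univ : Finset (Option (Fin m)))
      (f := fun o z ↦ o.elim (-J z) fun k ↦ (1 / 2) * ∑ l, fderiv ℝ (A k l) z (e l))
      (fun o _ ↦ ?_) (hD hψ p) (fun o ↦ o.elim et fun k ↦ e k)]
    · rw [Fintype.sum_option]
      simp only [Option.elim_none, Option.elim_some]
      have hneg : fderiv ℝ (fun z ↦ -J z * ψ z) p et = -fderiv ℝ (fun z ↦ J z * ψ z) p et := by
        rw [show (fun z ↦ -J z * ψ z) = fun z ↦ -(J z * ψ z) from funext fun z ↦ by ring,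
          fderiv_fun_neg]
        rfl
      rw [hneg]
      change -(-fderiv ℝ (fun z ↦ J z * ψ z) p et + ∑ k, fderiv ℝ (fun z ↦ β k z * ψ z) p (e k)) = _
      ring
    · cases o with
      | none => exact (hD hJ p).neg
      | some k => exact hD (hβs k) p
  -- (4) assembly
  unfold hormanderTranspose
  rw [hsquares, hY0, heatTranspose_apply]
  ring

/-! ### The bracket condition: `Y₁, …, Y_r, Y₀` already span -/

omit [Fintype ι] in
/-- **Hörmander's bracket condition holds at step zero**: if a sub-family `a ↦ w_{σ a}` of the
constant vectors spans `ℝᵐ`, the corresponding `g_{σ a}` vanish nowhere and `J ≠ 0` on `U`,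
then the values of the fields `Yⱼ = gⱼ (wⱼ, 0)` and `Y₀ = (…, −J)` span `ℝᵐ × ℝ` at every
point of `U`; a fortiori the iterated brackets do. [cite: Hormander1967, Thm 1.1] -/
theorem isBracketGenerating_heat {A : Fin m → Fin m → 𝔼 → ℝ} {J : 𝔼 → ℝ}
    {w : ι → Fin m → ℝ} {g : ι → 𝔼 → ℝ} {κ' : Type*} (σ : κ' → ι)
    (hgσ : ∀ a z, g (σ a) z ≠ 0)
    (hspan : ∀ v : Fin m → ℝ, v ∈ Submodule.span ℝ (Set.range fun a ↦ w (σ a)))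
    {U : Set 𝔼} (hJ : ∀ z ∈ U, J z ≠ 0) :
    IsBracketGenerating (fun o : Option ι ↦ o.elim (heatDriftField A J) (heatSquareField w g))
      U := by
  classical
  intro x hx
  set S : Set 𝔼 := {v : 𝔼 | ∃ V : 𝔼 → 𝔼, IsIteratedLieBracket
    (fun o : Option ι ↦ o.elim (heatDriftField A J) (heatSquareField w g)) V ∧ V x = v} with hS
  set e : Fin m → 𝔼 := fun k ↦ ((𝐛 k : EuclideanSpace ℝ (Fin m)), (0 : ℝ)) with he
  set et : 𝔼 := ((0 : EuclideanSpace ℝ (Fin m)), (1 : ℝ)) with het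
  set L : (Fin m → ℝ) →ₗ[ℝ] 𝔼 := Fintype.linearCombination ℝ e with hL
  have hLapply : ∀ v : Fin m → ℝ, L v = ∑ k, v k • e k := fun v ↦
    Fintype.linearCombination_apply ℝ e v
  -- the generators are in `S`
  have hY0 : heatDriftField A J x ∈ S :=
    ⟨_, IsIteratedLieBracket.of (X := fun o : Option ι ↦ o.elim (heatDriftField A J)
      (heatSquareField w g)) none, rfl⟩
  have hYj : ∀ j, heatSquareField w g j x ∈ S := fun j ↦
    ⟨_, IsIteratedLieBracket.of (X := fun o : Option ι ↦ o.elim (heatDriftField A J)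
      (heatSquareField w g)) (some j), rfl⟩
  -- the spatial directions: `L v ∈ span S` for every `v`
  have hLw : ∀ a, L (w (σ a)) ∈ Submodule.span ℝ S := by
    intro a
    have h1 : L (w (σ a)) = (g (σ a) x)⁻¹ • heatSquareField w g (σ a) x := by
      rw [hLapply, heatSquareField, smul_smul, inv_mul_cancel₀ (hgσ a x), one_smul]
    rw [h1]
    exact Submodule.smul_mem _ _ (Submodule.subset_span (hYj (σ a)))
  have hLv : ∀ v : Fin m → ℝ, L v ∈ Submodule.span ℝ S := by
    intro v
    have hmap : Submodule.map L (Submodule.span ℝ (Set.range fun a ↦ w (σ a))) ≤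
        Submodule.span ℝ S := by
      rw [Submodule.map_span, Submodule.span_le]
      rintro _ ⟨_, ⟨a, rfl⟩, rfl⟩
      exact hLw a
    exact hmap ⟨v, hspan v, rfl⟩
  -- the time direction
  have het_mem : et ∈ Submodule.span ℝ S := by
    have hdec : heatDriftField A J x =
        L (fun k ↦ (1 / 2) * ∑ l, fderiv ℝ (A k l) x (e l)) + (-J x) • et := by
      rw [hLapply, heatDriftField, Fintype.sum_option]
      simp only [Option.elim_none, Option.elim_some]
      rw [add_comm]
    have h2 : et = (-J x)⁻¹ • (heatDriftField A J x -
        L (fun k ↦ (1 / 2) * ∑ l, fderiv ℝ (A k l) x (e l))) := by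
      rw [hdec, add_sub_cancel_left, smul_smul, inv_mul_cancel₀ (neg_ne_zero.mpr (hJ x hx)),
        one_smul]
    rw [h2]
    exact Submodule.smul_mem _ _ (Submodule.sub_mem _ (Submodule.subset_span hY0) (hLv _))
  -- every vector is `L(y) + t et`
  rw [eq_top_iff]
  rintro ⟨y, t⟩ -
  have hfst : ∀ v : Fin m → ℝ, (L v).1 = ∑ k, v k • (𝐛 k : EuclideanSpace ℝ (Fin m)) := by
    intro v
    rw [hLapply, Prod.fst_sum]
    refine Finset.sum_congr rfl fun k _ ↦ ?_
    rw [Prod.smul_fst]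
  have hsnd : ∀ v : Fin m → ℝ, (L v).2 = 0 := by
    intro v
    rw [hLapply, Prod.snd_sum]
    refine Finset.sum_eq_zero fun k _ ↦ ?_
    rw [Prod.smul_snd, he]
    exact smul_zero _
  have hysum : ∑ k, y k • (𝐛 k : EuclideanSpace ℝ (Fin m)) = y := by
    conv_rhs => rw [← (EuclideanSpace.basisFun (Fin m) ℝ).sum_repr' y]
    refine Finset.sum_congr rfl fun k _ ↦ ?_
    rw [OrthonormalBasis.coe_toBasis]
    congr 1
    rw [EuclideanSpace.basisFun_apply, EuclideanSpace.inner_single_left]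
    simp
  have hy : ((y, t) : 𝔼) = L (fun k ↦ y k) + t • et := by
    refine Prod.ext ?_ ?_
    · rw [Prod.fst_add, hfst, Prod.smul_fst, het, hysum]
      simp
    · rw [Prod.snd_add, hsnd, Prod.smul_snd, het]
      simp
  rw [hy]
  exact Submodule.add_mem _ (hLv _) (Submodule.smul_mem _ _ het_mem)

/-! ### Localisation of the transpose -/

omit [Fintype ι] in
/-- `heatTranspose` only sees the data near the support of the test function: if two sets of
data agree on an open set containing `tsupport ψ`, the transposes agree everywhere. [folklore] -/
theorem heatTranspose_congr_of_eqOn {A A' : Fin m → Fin m → 𝔼 → ℝ} {J J' q q' : 𝔼 → ℝ}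
    {U : Set 𝔼} (hU : IsOpen U) (hA : ∀ k l, EqOn (A k l) (A' k l) U) (hJ : EqOn J J' U)
    (hq : EqOn q q' U) {ψ : 𝔼 → ℝ} (hψU : tsupport ψ ⊆ U) :
    heatTranspose A J q ψ = heatTranspose A' J' q' ψ := by
  funext p
  simp only [heatTranspose_apply]
  by_cases hp : p ∈ tsupport ψ
  · have hpU : U ∈ 𝓝 p := hU.mem_nhds (hψU hp)
    have h1 : (fun z ↦ J z * ψ z) =ᶠ[𝓝 p] fun z ↦ J' z * ψ z := by
      filter_upwards [hpU] with z hz; rw [hJ hz]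
    have h2 : ∀ k, (fun z ↦ ∑ l, A k l z * fderiv ℝ ψ z (𝐛 l, 0)) =ᶠ[𝓝 p]
        fun z ↦ ∑ l, A' k l z * fderiv ℝ ψ z (𝐛 l, 0) := by
      intro k
      filter_upwards [hpU] with z hz
      exact Finset.sum_congr rfl fun l _ ↦ by rw [hA k l hz]
    have h2' : ∀ k, fderiv ℝ (fun z ↦ ∑ l, A k l z * fderiv ℝ ψ z (𝐛 l, 0)) p =
        fderiv ℝ (fun z ↦ ∑ l, A' k l z * fderiv ℝ ψ z (𝐛 l, 0)) p := fun k ↦ (h2 k).fderiv_eq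
    rw [h1.fderiv_eq, hq (hψU hp)]
    simp only [h2']
  · -- off the support everything vanishes
    have hev : ψ =ᶠ[𝓝 p] 0 := notMem_tsupport_iff_eventuallyEq.1 hp
    have hev' : ∀ᶠ z in 𝓝 p, z ∉ tsupport ψ := (isClosed_tsupport ψ).isOpen_compl.mem_nhds hp
    have hJψ : ∀ J₁ : 𝔼 → ℝ, (fun z ↦ J₁ z * ψ z) =ᶠ[𝓝 p] fun _ ↦ 0 := by
      intro J₁; filter_upwards [hev] with z hz; rw [hz, Pi.zero_apply, mul_zero]
    have hAψ : ∀ (A₁ : Fin m → Fin m → 𝔼 → ℝ) k,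
        (fun z ↦ ∑ l, A₁ k l z * fderiv ℝ ψ z (𝐛 l, 0)) =ᶠ[𝓝 p] fun _ ↦ 0 := by
      intro A₁ k
      filter_upwards [hev'] with z hz
      refine Finset.sum_eq_zero fun l _ ↦ ?_
      rw [fderiv_apply_eq_zero_of_notMem_tsupport hz, mul_zero]
    have h0 : ∀ (A₁ : Fin m → Fin m → 𝔼 → ℝ) k,
        fderiv ℝ (fun z ↦ ∑ l, A₁ k l z * fderiv ℝ ψ z (𝐛 l, 0)) p = 0 := fun A₁ k ↦ by
      rw [(hAψ A₁ k).fderiv_eq]; exact fderiv_const_apply 0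
    have h0' : ∀ J₁ : 𝔼 → ℝ, fderiv ℝ (fun z ↦ J₁ z * ψ z) p = 0 := fun J₁ ↦ by
      rw [(hJψ J₁).fderiv_eq]; exact fderiv_const_apply 0
    simp only [h0, h0', image_eq_zero_of_notMem_tsupport hp, mul_zero]

/-! ### Interior regularity -/

/-- **Interior regularity of very weak solutions of parabolic equations with smooth
coefficients, from Hörmander's theorem.** On an open set `Ω ⊆ ℝᵐ × ℝ` let `A = (Aₖₗ)` be
smooth, symmetric and positive definite, `J > 0`, `q`, `F` smooth, and let `u ∈ L¹_loc(Ω)`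
satisfy `∫ u · heatTranspose A J q ψ = ∫ F ψ` for every smooth `ψ` compactly supported in `Ω`
(a very weak solution of `J ∂ₛu − ∑ₖ∂ₖ(Aₖₗ∂ₗu) + q u = F`, i.e. of the heat-type equation
`(∂ₛ − Δ_{h(s)} + Q) u = F/J` in a chart). Then every point of `Ω` has an open neighbourhood
`U ⊆ Ω` on which `u` agrees a.e. with a `C^∞` function. Proof: cut the data off near `p₀`
(keeping `A` uniformly close to `A(p₀)`), write `A = ∑ⱼ gⱼ² wⱼwⱼᵀ`
(`exists_smooth_sumOfSquares`), so that `−(transposed operator) = ᵗP` for Hörmander's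
`P = ∑ⱼ Yⱼ² + Y₀ + c` (`hormanderTranspose_eq_neg_heatTranspose`), whose fields span at every
point (`isBracketGenerating_heat`); by Hörmander 1967, Thm 1.1 (PROVED in this tree:
`hormander1967_thm11_proof`) `P` is hypoelliptic, so the distribution `u dx` — whose image
`−F` is smooth — is smooth on `U`, and the fundamental lemma of the calculus of variations
identifies `u` with the smooth representative. [cite: Hormander1967, Thm 1.1] -/
theorem exists_contDiffOn_ae_eq_of_heat_veryWeak {Ω : Set 𝔼} (hΩ : IsOpen Ω)
    {A : Fin m → Fin m → 𝔼 → ℝ} (hA : ∀ k l, ContDiffOn ℝ ∞ (A k l) Ω)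
    (hAsymm : ∀ k l p, A k l p = A l k p)
    (hpos : ∀ p ∈ Ω, ∀ v : Fin m → ℝ, v ≠ 0 → 0 < ∑ k, ∑ l, A k l p * (v k * v l))
    {J : 𝔼 → ℝ} (hJ : ContDiffOn ℝ ∞ J Ω) (hJpos : ∀ p ∈ Ω, 0 < J p)
    {q : 𝔼 → ℝ} (hq : ContDiffOn ℝ ∞ q Ω) {F : 𝔼 → ℝ} (hF : ContDiffOn ℝ ∞ F Ω)
    {u : 𝔼 → ℝ} (hu : LocallyIntegrableOn u Ω volume)
    (hweak : ∀ ψ : 𝔼 → ℝ, ContDiff ℝ ∞ ψ → HasCompactSupport ψ → tsupport ψ ⊆ Ω →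
      ∫ p, u p * heatTranspose A J q ψ p = ∫ p, F p * ψ p)
    {p₀ : 𝔼} (hp₀ : p₀ ∈ Ω) :
    ∃ U : Set 𝔼, IsOpen U ∧ p₀ ∈ U ∧ U ⊆ Ω ∧
      ∃ v : 𝔼 → ℝ, ContDiffOn ℝ ∞ v U ∧ ∀ᵐ p, p ∈ U → u p = v p := by
  classical
  -- the sum-of-squares data at `p₀`
  obtain ⟨δ, hδ, w, hspan, hdec⟩ := exists_smooth_sumOfSquares (X := 𝔼)
    (A₀ := fun k l ↦ A k l p₀) (fun k l ↦ hAsymm k l p₀) (hpos p₀ hp₀)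
  -- a ball in `Ω` on which `A` is `δ`-close to `A(p₀)`
  have hcont : ∀ k l, ContinuousAt (A k l) p₀ := fun k l ↦
    ((hA k l).continuousOn.continuousWithinAt hp₀).continuousAt (hΩ.mem_nhds hp₀)
  have hev : ∀ᶠ p in 𝓝 p₀, p ∈ Ω ∧ ∀ k l, |A k l p - A k l p₀| ≤ δ := by
    have h1 : ∀ᶠ p in 𝓝 p₀, p ∈ Ω := hΩ.mem_nhds hp₀
    refine h1.and ?_
    rw [Filter.eventually_all]
    intro k
    rw [Filter.eventually_all]
    intro l
    have h := Metric.tendsto_nhds.1 (hcont k l) δ hδ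
    filter_upwards [h] with p hp
    exact (le_of_lt hp : dist (A k l p) (A k l p₀) ≤ δ)
  obtain ⟨ε, hε, hball⟩ := Metric.eventually_nhds_iff_ball.1 hev
  -- cut-off equal to `1` on `closedBall p₀ (ε/4)`, supported in `ball p₀ (ε/2)`
  let χ : ContDiffBump p₀ := ⟨ε / 4, ε / 2, by positivity, by linarith⟩
  have hχ1 : ∀ p ∈ closedBall p₀ (ε / 4), χ p = 1 := fun p hp ↦ χ.one_of_mem_closedBall hp
  have hχsupp : tsupport (χ : 𝔼 → ℝ) ⊆ ball p₀ ε := by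
    rw [χ.tsupport_eq]; exact closedBall_subset_ball (by show ε / 2 < ε; linarith)
  have hballΩ : ball p₀ ε ⊆ Ω := fun p hp ↦ (hball p hp).1
  have hχΩ : tsupport (χ : 𝔼 → ℝ) ⊆ Ω := hχsupp.trans hballΩ
  have hχs : ContDiff ℝ ∞ (χ : 𝔼 → ℝ) := χ.contDiff
  obtain ⟨U, hU⟩ : ∃ U : Set 𝔼, U = ball p₀ (ε / 4) := ⟨_, rfl⟩
  have hUo : IsOpen U := by rw [hU]; exact isOpen_ball
  have hUcb : U ⊆ closedBall p₀ (ε / 4) := by rw [hU]; exact ball_subset_closedBall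
  have hUΩ : U ⊆ Ω := by rw [hU]; exact (ball_subset_ball (by linarith)).trans hballΩ
  have hp₀U : p₀ ∈ U := by rw [hU]; exact mem_ball_self (by positivity)
  have hχU : ∀ p ∈ U, χ p = 1 := fun p hp ↦ hχ1 p (hUcb hp)
  -- the cut-off data, smooth on the whole space and unchanged on `U`
  obtain ⟨Ah, hAh⟩ : ∃ Ah : Fin m → Fin m → 𝔼 → ℝ,
      ∀ k l z, Ah k l z = χ z * A k l z + (1 - χ z) * A k l p₀ :=
    ⟨fun k l z ↦ χ z * A k l z + (1 - χ z) * A k l p₀, fun _ _ _ ↦ rfl⟩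
  obtain ⟨Jh, hJh⟩ : ∃ Jh : 𝔼 → ℝ, ∀ z, Jh z = χ z * J z + (1 - χ z) :=
    ⟨fun z ↦ χ z * J z + (1 - χ z), fun _ ↦ rfl⟩
  obtain ⟨qh, hqh⟩ : ∃ qh : 𝔼 → ℝ, ∀ z, qh z = χ z * q z := ⟨fun z ↦ χ z * q z, fun _ ↦ rfl⟩
  have hAh_s : ∀ k l, ContDiff ℝ ∞ (Ah k l) := by
    intro k l
    have : Ah k l = fun z ↦ χ z * A k l z + (1 - χ z) * A k l p₀ := funext (hAh k l)
    rw [this]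
    exact (contDiff_mul_of_tsupport_subset hΩ hχs hχΩ (hA k l)).add
      ((contDiff_const.sub hχs).mul contDiff_const)
  have hJh_s : ContDiff ℝ ∞ Jh := by
    have : Jh = fun z ↦ χ z * J z + (1 - χ z) := funext hJh
    rw [this]
    exact (contDiff_mul_of_tsupport_subset hΩ hχs hχΩ hJ).add (contDiff_const.sub hχs)
  have hqh_s : ContDiff ℝ ∞ qh := by
    have : qh = fun z ↦ χ z * q z := funext hqh
    rw [this]
    exact contDiff_mul_of_tsupport_subset hΩ hχs hχΩ hq
  have hAhU : ∀ k l, EqOn (Ah k l) (A k l) U := fun k l z hz ↦ by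
    rw [hAh, hχU z hz]; ring
  have hJhU : EqOn Jh J U := fun z hz ↦ by rw [hJh, hχU z hz]; ring
  have hqhU : EqOn qh q U := fun z hz ↦ by rw [hqh, hχU z hz]; ring
  have hAh_symm : ∀ k l z, Ah k l z = Ah l k z := fun k l z ↦ by
    rw [hAh, hAh, hAsymm k l z, hAsymm k l p₀]
  have hAh_close : ∀ k l z, |Ah k l z - A k l p₀| ≤ δ := by
    intro k l z
    have hχ01 : 0 ≤ χ z ∧ χ z ≤ 1 := ⟨χ.nonneg, χ.le_one⟩
    rw [hAh, show χ z * A k l z + (1 - χ z) * A k l p₀ - A k l p₀ =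
      χ z * (A k l z - A k l p₀) by ring, abs_mul, abs_of_nonneg hχ01.1]
    by_cases hz : z ∈ ball p₀ ε
    · calc χ z * |A k l z - A k l p₀| ≤ 1 * δ :=
            mul_le_mul hχ01.2 ((hball z hz).2 k l) (abs_nonneg _) zero_le_one
        _ = δ := one_mul δ
    · have hz' : z ∉ tsupport (χ : 𝔼 → ℝ) := fun h ↦ hz (hχsupp h)
      rw [image_eq_zero_of_notMem_tsupport hz', zero_mul]
      exact hδ.le
  have hJhU_ne : ∀ z ∈ U, Jh z ≠ 0 := fun z hz ↦ by
    rw [hJhU hz]; exact (hJpos z (hUΩ hz)).ne'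
  -- the sum-of-squares decomposition of the cut-off matrix field
  obtain ⟨g, hg, hgpos, hdecomp⟩ := hdec Ah hAh_s hAh_symm hAh_close
  -- Hörmander: the operator is hypoelliptic on `U`
  haveI : (volume : Measure 𝔼).IsAddHaarMeasure := by
    rw [show (volume : Measure 𝔼) =
      (volume : Measure (EuclideanSpace ℝ (Fin m))).prod (volume : Measure ℝ) from rfl]
    infer_instance
  let UO : Opens 𝔼 := ⟨U, hUo⟩
  have hbr : IsBracketGenerating (fun o : Option (Fin m ⊕ (Fin m × Fin m × Bool)) ↦
      o.elim (heatDriftField Ah Jh) (heatSquareField w g)) (UO : Set 𝔼) :=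
    isBracketGenerating_heat Sum.inl (fun a z ↦ (hgpos a z).ne') hspan hJhU_ne
  have hhyp : IsHypoellipticOn UO
      (hormanderTranspose (heatDriftField Ah Jh) (heatSquareField w g) fun z ↦ -qh z) volume :=
    Literature.Analysis.Hypoelliptic.hormander1967_thm11_proof 𝔼 volume
      (Fin m ⊕ (Fin m × Fin m × Bool)) UO (heatDriftField Ah Jh) (heatSquareField w g)
      (fun z ↦ -qh z) (contDiff_heatDriftField hAh_s hJh_s) (contDiff_heatSquareField hg)
      hqh_s.neg hbr
  -- the distribution `u dx` on `U`
  have huU : LocallyIntegrableOn u U volume := hu.mono_set hUΩ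
  let uD : 𝓓'(UO, ℝ) :=
    (TestFunction.integralAgainstBilinCLM (ContinuousLinearMap.mul ℝ ℝ) volume u :
      𝓓(UO, ℝ) →L[ℝ] ℝ)
  have huD : ∀ φ : 𝓓(UO, ℝ), uD φ = ∫ x, φ x * u x := by
    intro φ
    change TestFunction.integralAgainstBilinCLM (ContinuousLinearMap.mul ℝ ℝ) volume u φ = _
    rw [TestFunction.integralAgainstBilinCLM_eq_integral huU]
    simp
  -- its image under the operator is the smooth function `−F` on `U`
  have himg : Distribution.ImageIsSmoothOn uD
      (hormanderTranspose (heatDriftField Ah Jh) (heatSquareField w g) fun z ↦ -qh z)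
      volume U := by
    refine ⟨fun z ↦ -F z, (hF.mono hUΩ).neg, fun φ ψ hφU hψ ↦ ?_⟩
    rw [huD ψ]
    have hT : heatTranspose Ah Jh qh φ = heatTranspose A J q φ :=
      heatTranspose_congr_of_eqOn hUo hAhU hJhU hqhU hφU
    calc ∫ x, ψ x * u x
        = ∫ x, u x * (-heatTranspose A J q φ x) := by
          refine integral_congr_ae (Eventually.of_forall fun x ↦ ?_)
          dsimp only
          rw [hψ, hormanderTranspose_eq_neg_heatTranspose hg hdecomp hJh_s φ.contDiff x, hT,
            mul_comm]
      _ = -∫ x, u x * heatTranspose A J q φ x := by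
          rw [← integral_neg]
          exact integral_congr_ae (Eventually.of_forall fun x ↦ by simp)
      _ = ∫ x, (-F x) * φ x := by
          rw [hweak φ φ.contDiff φ.hasCompactSupport (hφU.trans hUΩ), ← integral_neg]
          exact integral_congr_ae (Eventually.of_forall fun x ↦ by simp)
  obtain ⟨v, hv, hvint⟩ := hhyp uD U hUo Subset.rfl himg
  refine ⟨U, hUo, hp₀U, hUΩ, v, hv, ?_⟩
  -- `u = v` a.e. on `U` by the fundamental lemma of the calculus of variations
  have hvU : LocallyIntegrableOn v U volume := hv.continuousOn.locallyIntegrableOn hUo.measurableSet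
  have hz := hUo.ae_eq_zero_of_integral_contDiff_smul_eq_zero (μ := volume)
    (f := fun x ↦ u x - v x) (huU.sub hvU) (fun φ hφ hφc hφU ↦ by
      let φg : 𝓓(UO, ℝ) := ⟨φ, hφ, hφc, hφU⟩
      have h1 : ∫ x, φ x * u x = ∫ x, v x * φ x := by
        have := hvint φg hφU
        rw [huD] at this
        exact this
      have hi1 : Integrable (fun x ↦ φ x * u x) :=
        TestFunction.integrable_bilin (ContinuousLinearMap.mul ℝ ℝ) huU φg
      have hi2 : Integrable (fun x ↦ φ x * v x) :=
        TestFunction.integrable_bilin (ContinuousLinearMap.mul ℝ ℝ) hvU φg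
      simp only [smul_eq_mul, mul_sub]
      rw [integral_sub hi1 hi2, h1, sub_eq_zero]
      exact integral_congr_ae (Eventually.of_forall fun x ↦ mul_comm _ _))
  filter_upwards [hz] with x hx hxU
  exact sub_eq_zero.1 (hx hxU)

end Heat

end Literature.Analysis.Distribution
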